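import Summits.QuantumFields.YangMills.Theorems.FlatTubeReductionProfileInterfaceSlowTail
import HarnessLib

/-!
# PROFILE INTERFACE, slow tail — FP WINDOW OF RADIUS `β⁻¹`: `profile_slow_tail` of `…ProfileInterfaceSlowTail` with the floor hypothesis `c_l·β⁻¹ ≤ ε ≤ 2` instead of
# `c_l·(√β)⁻¹ ≤ ε`, the polynomial loss becoming `(√β)^{3n+6}` (route `FlatTubeReduction`, crux K1 `NearFlatRatioLaw` stmt-QuantumFields-24720; seat `ym-line-ftr-p1` g15;
# rate twin «ratepack-v3 / frozen fibres»; R2b1 RECORD rung — no summit statement is proved here)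

WHY (PICKED.md g15; NOTES T5).  The DRESSING of the rate twin must be the exact diagonal ratio of the colour-localised kernel at Faddeev–Popov radius `ε = β⁻¹` (lane A's weight of
record): at the `(√β)⁻¹` of g14's package the colour smearing of NEAR pairs is `(Bαδ₁ε)² ≍ β^{-1/3}log β ≫ λ_b²` (the pinned colour sum `Γ = |Λ|ε` enters `η` through `216·α·δ·Γ`).
The F8 chain (`exactDressing_fields` ← profile interface) is generic in `ε` (`βε² ≤ c_ε`) except the slow tail, whose crude fibre tails lose the FP volume `fpZ ε ≥ (ε/2)³/10`; with
`ε ≥ c_lβ⁻¹ = c_l s²` (`s = (√β)⁻¹`) the loss is `(√β)^{3n+6}` — still polynomial, still beaten by the Gaussian profile tail `t ≍ e^{−cβ^{1/8}}`.  Same proof, `slow_fib_coeff` called with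
`c_l·s` in place of `c_l`.
  ★★★ `profile_slow_tail_sq`.
HONEST FRAMING: bookkeeping; femto rung R2b1 (RECORD label); not infinite volume, not a gap, not Clay.  No defs, no named facts, no `sorry`.
-/

set_option autoImplicit false

noncomputable section

open MeasureTheory Filter Topology Real Set
open scoped BigOperators
open Literature.MathematicalPhysics.QuantumFieldTheory
open Literature.MathematicalPhysics.QuantumLattice

namespace Summit.QuantumFields.YangMills.Theorems.FemtoTransferGap.RateTube

open Summit.QuantumFields.YangMills.Theorems.FemtoTransferGap
open Summit.QuantumFields.YangMills.Theorems.FemtoTransferGap.TwoLattice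
open Summit.QuantumFields.YangMills.Theorems.FemtoTransferGap.TwoLattice.ConstTube
open Summit.QuantumFields.YangMills.Theorems.FemtoTransferGap.TwoLattice.Avg
open Summit.QuantumFields.YangMills.Theorems.FemtoTransferGap.TwoLattice.Cov
open Summit.QuantumFields.YangMills.Theorems.FemtoTransferGap.TwoLattice.Stiff (LinkSpace)

variable {L : ℕ} [NeZero L]

set_option maxHeartbeats 3200000 in
/-- ★★★ **THE SLOW TAIL `η_u` FROM PROFILE-NUMBER RATIOS, FP window of radius `≥ c_l·β⁻¹`** (fixed `β ≥ 900`, slow datum `u`, colour rotation `d`).  Constants `C₁, C₂ ≥ 0` depend on `L, A, c_l` only.  Profile `Ω`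
(measurable, `0 ≤ Ω ≤ CΩ`, support in the capped balanced set with `‖v̂‖ ≤ R` and coordinates `|v_{e,c}| ≤ R_τ ≤ 1/30`), FP window `c_l·β⁻¹ ≤ ε ≤ 2` (the loss is `(√β)^{3n+6}` instead of `(√β)^{3n+3}`), fibre core `C` as in
`profile_moment_number` with `θ = ∫_C Ω > 0`, `I₀ ≤ Aθ`, `M_{3n} ≤ Aθ`; a level `T`, an auxiliary `D ≥ 0` and a fibre-tail ratio `∫_{T<β‖v̂‖²}Ω ≤ tθ`; the slow datum has
`12L³orbitDist u⁴ < 2` and satisfies the three smallness conditions of `slow_core_tail_le` (`r_T = √(T/β)`).  Then with `w = dud⁻¹`: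
`∫_{S′(T)ᶜ} ρ_w dμP / K(u,u) ≤ e^{β·E(R_τ, 12L³orbitDist u⁴)}·(C₁·e^{−βD/2}·(1 + 2(√β·(3·orbitDist u))^{3n}) + C₂·t·(√β)^{3n+6})·(∫ρ₁ dμP/K₁(1,1))`. [cite: Luscher1983, §3] -/
theorem profile_slow_tail_sq {A cl : ℝ} (hA : 0 ≤ A) (hcl : 0 < cl) :
    ∃ C₁ C₂ : ℝ, 0 ≤ C₁ ∧ 0 ≤ C₂ ∧ ∀ {β : ℝ}, 900 ≤ β → ∀ {Ω : LinkSpace L → ℝ}, Measurable Ω → ∀ {CΩ : ℝ}, (∀ x, |Ω x| ≤ CΩ) → (∀ x, 0 ≤ Ω x) → ∀ {R : ℝ},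
      (∀ v : Edge 3 L → Fin 3 → ℝ, Ω (linkEmbed L v) ≠ 0 → v ∈ capBalancedSet L ∧ ‖linkEmbed L v‖ ≤ R) → ∀ {Rτ : ℝ}, Rτ ≤ 1 / 30 →
      (∀ v : Edge 3 L → Fin 3 → ℝ, Ω (linkEmbed L v) ≠ 0 → ∀ (e : Edge 3 L) (c : Fin 3), |v e c| ≤ Rτ) →
      ∀ {ε : ℝ}, cl * β⁻¹ ≤ ε → ε ≤ 2 →
      ∀ {C : Set (Edge 3 L → Fin 3 → ℝ)}, MeasurableSet C →
      (∀ v ∈ C, v ∈ capBalancedSet L ∧ ‖linkEmbed L v‖ ≤ (Real.sqrt β)⁻¹ ∧ ∀ (e : Edge 3 L) (c : Fin 3), |v e c| ≤ (Real.sqrt β)⁻¹) →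
      0 < ∫ v in C, Ω (linkEmbed L v) ∂orthoTransverse L →
      ∫ v, Ω (linkEmbed L v) ∂orthoTransverse L ≤ A * ∫ v in C, Ω (linkEmbed L v) ∂orthoTransverse L →
      ∫ v, Ω (linkEmbed L v) * (Real.sqrt β * ‖linkEmbed L v‖) ^ (3 * Fintype.card {x : Site 3 L // ¬x = 0}) ∂orthoTransverse L ≤ A * ∫ v in C, Ω (linkEmbed L v) ∂orthoTransverse L →
      ∀ (T : ℝ) {D : ℝ}, 0 ≤ D → ∀ {t : ℝ}, 0 ≤ t →
      ∫ v in {v | T < β * ‖linkEmbed L v‖ ^ 2}, Ω (linkEmbed L v) ∂orthoTransverse L ≤ t * ∫ v in C, Ω (linkEmbed L v) ∂orthoTransverse L →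
      ∀ (u : GaugeConfig 3 1 SU2), (L : ℝ) ^ 3 * (12 * orbitDist u ^ 4) < 2 →
      3 * L * (Real.sqrt D + 4 * (Real.sqrt 2 * Real.sqrt (T / β) + orbitDist u) + Real.sqrt 2 * (Real.sqrt (T / β) + Real.sqrt (T / β))) < 1 →
      9 * L * (Real.sqrt D + 4 * (Real.sqrt 2 * Real.sqrt (T / β) + orbitDist u) + Real.sqrt 2 * (Real.sqrt (T / β) + Real.sqrt (T / β))) + ε ≤ 2 →
      β * (2 * D + 8 * (Fintype.card (Edge 3 L) : ℝ) * orbitDist u ^ 2 *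
        ((9 * L * (Real.sqrt D + Real.sqrt 2 * (Real.sqrt (T / β) + Real.sqrt (T / β))) + ε) *
            (1 + 18 * L * (Real.sqrt 2 * Real.sqrt (T / β) + orbitDist u) + (18 * L * (Real.sqrt 2 * Real.sqrt (T / β) + orbitDist u)) ^ 2) +
          (18 * L * (Real.sqrt 2 * Real.sqrt (T / β) + orbitDist u)) ^ 2 * (36 * L * (Real.sqrt 2 * Real.sqrt (T / β) + orbitDist u))) ^ 2) ≤ T →
      ∀ d : SU2,
      (∫ p in ({p : (Edge 3 L → Fin 3 → ℝ) × ((Edge 3 L → Fin 3 → ℝ) × (Site 3 L → SU2)) | β * kinDefect L (orthoTube L 1 p.1) (orthoTube L 1 p.2.1) p.2.2 ≤ T} ∩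
          {p | β * ‖linkEmbed L p.1‖ ^ 2 ≤ T} ∩ {p | β * ‖linkEmbed L p.2.1‖ ^ 2 ≤ T} ∩
          {p | Ω (linkEmbed L p.1) ≠ 0 ∧ Ω (linkEmbed L p.2.1) ≠ 0 ∧ fpWeight L ε p.2.2 ≠ 0})ᶜ,
        fpTriple L β Ω (fpWeight L ε) (gaugeTransform (fun _ : Site 3 1 => d) u) (gaugeTransform (fun _ : Site 3 1 => d) u) p
        ∂((orthoTransverse L).prod ((orthoTransverse L).prod (gaugeMeasure L)))) / transferKernel su2Rep ((L : ℝ) ^ 3 * β) u u ≤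
      Real.exp (β * stepActionErr (L := L) Rτ ((L : ℝ) ^ 3 * (12 * orbitDist u ^ 4))) *
        (C₁ * Real.exp (-(β * D / 2)) * (1 + 2 * (Real.sqrt β * (3 * orbitDist u)) ^ (3 * Fintype.card {x : Site 3 L // ¬x = 0})) +
          C₂ * t * Real.sqrt β ^ (3 * Fintype.card {x : Site 3 L // ¬x = 0} + 6)) *
        ((∫ p, fpTriple L β Ω (fpWeight L ε) 1 1 p ∂((orthoTransverse L).prod ((orthoTransverse L).prod (gaugeMeasure L)))) /
          transferKernel su2Rep ((L : ℝ) ^ 3 * β) (1 : GaugeConfig 3 1 SU2) 1) := by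
  have habc0 : 0 ≤ (π ^ 2 / 12) ^ Fintype.card {x : Site 3 L // ¬x = 0} * (3 * (L : ℝ)) ^ (3 * Fintype.card {x : Site 3 L // ¬x = 0}) * 3 ^ (3 * Fintype.card {x : Site 3 L // ¬x = 0}) := by
    positivity
  have hc50 : 0 ≤ (5 * Real.sqrt 2) ^ (3 * Fintype.card {x : Site 3 L // ¬x = 0}) + Real.sqrt 2 ^ (3 * Fintype.card {x : Site 3 L // ¬x = 0}) := by positivity
  have hcstar0 : 0 < Real.exp (-((Fintype.card (Edge 3 L) : ℝ) * (2 + 2 * Real.sqrt 2) ^ 2 + 100 * (Fintype.card (Plaquette 3 L × Fin 3) : ℝ) +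
      729945 * (Fintype.card (Plaquette 3 L) : ℝ))) := Real.exp_pos _
  refine ⟨5 * Real.exp (1 / 2) * 4 ^ (3 * Fintype.card {x : Site 3 L // ¬x = 0}) * (3 * Fintype.card {x : Site 3 L // ¬x = 0}).factorial *
      ((π ^ 2 / 12) ^ Fintype.card {x : Site 3 L // ¬x = 0} * (3 * (L : ℝ)) ^ (3 * Fintype.card {x : Site 3 L // ¬x = 0}) * 3 ^ (3 * Fintype.card {x : Site 3 L // ¬x = 0})) *
      10 ^ Fintype.card {x : Site 3 L // ¬x = 0} *
      ((3 ^ (3 * Fintype.card {x : Site 3 L // ¬x = 0}) + ((5 * Real.sqrt 2) ^ (3 * Fintype.card {x : Site 3 L // ¬x = 0}) + Real.sqrt 2 ^ (3 * Fintype.card {x : Site 3 L // ¬x = 0}))) * A ^ 2) /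
      Real.exp (-((Fintype.card (Edge 3 L) : ℝ) * (2 + 2 * Real.sqrt 2) ^ 2 + 100 * (Fintype.card (Plaquette 3 L × Fin 3) : ℝ) + 729945 * (Fintype.card (Plaquette 3 L) : ℝ))),
    2 * (80 * 10 ^ Fintype.card {x : Site 3 L // ¬x = 0} * A /
      (Real.exp (-((Fintype.card (Edge 3 L) : ℝ) * (2 + 2 * Real.sqrt 2) ^ 2 + 100 * (Fintype.card (Plaquette 3 L × Fin 3) : ℝ) + 729945 * (Fintype.card (Plaquette 3 L) : ℝ))) * cl ^ 3)),
    by positivity, by positivity, ?_⟩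
  intro β hβ Ω hΩm CΩ hCΩ hΩ0 R hΩt Rτ hRτ hΩτ ε hεl hε2 C hC hCsub hθ hI hM T D hD t ht htail0 u hσ2 hsmall htwo hTD d
  haveI := isFiniteMeasure_orthoTransverse L
  haveI : SecondCountableTopology SU2 := secondCountableTopology_su2
  obtain ⟨hs0, hs30, hs1, hβs, hβ0⟩ := inv_sqrt_window hβ
  have hle := measurable_linkEmbed L
  have hεpos : 0 < ε := lt_of_lt_of_le (by positivity) hεl
  have hsq_inv : (Real.sqrt β)⁻¹ * (Real.sqrt β)⁻¹ = β⁻¹ := by rw [← mul_inv, Real.mul_self_sqrt hβ0.le]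
  have hfpZ : 0 < fpZ ε := fpZ_pos hεpos
  -- the conjugated slow datum
  set w : GaugeConfig 3 1 SU2 := gaugeTransform (fun _ : Site 3 1 => d) u with hw
  have hτ0 : 0 ≤ orbitDist u := orbitDist_nonneg u
  have hwu : orbitDist w = orbitDist u := by rw [hw, orbitDist_gaugeTransform]
  have hwτ : ∀ k : Fin 3, ‖su2Quat (w (0, k)) - 1‖ ≤ orbitDist u := fun k => by rw [← hwu]; exact norm_su2Quat_sub_one_le_orbitDist w (0, k)
  have hS : (L : ℝ) ^ 3 * wilsonAction su2Rep w ≤ (L : ℝ) ^ 3 * (12 * orbitDist u ^ 4) := by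
    refine mul_le_mul_of_nonneg_left (wilsonAction_one_site_le w (fun e => ?_)) (by positivity)
    have : e = (0, e.2) := by ext <;> simp [Subsingleton.elim e.1 0]
    rw [this]; exact hwτ e.2
  have hKw : transferKernel su2Rep ((L : ℝ) ^ 3 * β) w w = transferKernel su2Rep ((L : ℝ) ^ 3 * β) u u := by rw [hw, transferKernel_gaugeTransform]
  have hΩc : ∀ v : Edge 3 L → Fin 3 → ℝ, Ω (linkEmbed L v) ≠ 0 → v ∈ capBalancedSet L := fun v hv => (hΩt v hv).1
  -- the three bricks at `w`
  have h1 := slow_reference_tail_abs_le (L := L) hβ0 w hτ0 hwτ hσ2 hS hΩm hCΩ hΩ0 hRτ hΩt hΩτ ε (β * D)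
  have hR₁ : MeasurableSet {v : Edge 3 L → Fin 3 → ℝ | T < β * ‖linkEmbed L v‖ ^ 2} := measurableSet_lt measurable_const ((hle.norm.pow_const 2).const_mul β)
  have h2 := slow_mass_on_fibreSets_le (L := L) hβ0.le w hσ2 hS hΩm hCΩ hΩ0 hRτ hΩc hΩτ ε hR₁ (MeasurableSet.univ : MeasurableSet (Set.univ : Set (Edge 3 L → Fin 3 → ℝ)))
  have h3 := slow_mass_on_fibreSets_le (L := L) hβ0.le w hσ2 hS hΩm hCΩ hΩ0 hRτ hΩc hΩτ ε (MeasurableSet.univ : MeasurableSet (Set.univ : Set (Edge 3 L → Fin 3 → ℝ))) hR₁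
  -- the fibre radius at level `T`
  have hrT : ∀ r : ℝ, 0 ≤ r → β * r ^ 2 ≤ T → r ≤ Real.sqrt (T / β) := fun r hr h => by
    have h' : r ^ 2 ≤ T / β := by rw [le_div_iff₀ hβ0]; linarith
    calc r = Real.sqrt (r ^ 2) := (Real.sqrt_sq hr).symm
      _ ≤ Real.sqrt (T / β) := Real.sqrt_le_sqrt h'
  have hcore := slow_core_tail_le (L := L) hβ0 w hτ0 hwτ hΩm hCΩ hΩ0 hΩc hεpos.le T hrT hsmall htwo hTD h1 h2 h3
  rw [Measure.restrict_univ, hKw] at hcore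
  -- the floor and the FP volume
  have hfloor := reference_mass_ge_floor (L := L) hβ0 hΩm hCΩ hΩ0 hΩt hC hs30 hCsub ε hs0 hs1
  have hK1p : 0 < transferKernel su2Rep ((L : ℝ) ^ 3 * β) (1 : GaugeConfig 3 1 SU2) 1 := transferKernel_pos _ _ _ _
  have hZl : (cl * (Real.sqrt β)⁻¹ * (Real.sqrt β)⁻¹ / 2) ^ 3 / 10 ≤ fpZ ε := by
    refine le_trans ?_ (fpZ_ge_cube hεpos hε2)
    have : cl * (Real.sqrt β)⁻¹ * (Real.sqrt β)⁻¹ / 2 ≤ ε / 2 := by rw [mul_assoc, hsq_inv]; linarith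
    have h0 : 0 ≤ cl * (Real.sqrt β)⁻¹ * (Real.sqrt β)⁻¹ / 2 := by positivity
    exact div_le_div_of_nonneg_right (pow_le_pow_left₀ h0 this 3) (by norm_num)
  -- abbreviations (after the bricks)
  set n : ℕ := Fintype.card {x : Site 3 L // ¬x = 0} with hn
  set s : ℝ := (Real.sqrt β)⁻¹ with hs
  set c5 : ℝ := (5 * Real.sqrt 2) ^ (3 * n) + Real.sqrt 2 ^ (3 * n) with hc5
  set cstar : ℝ := Real.exp (-((Fintype.card (Edge 3 L) : ℝ) * (2 + 2 * Real.sqrt 2) ^ 2 + 100 * (Fintype.card (Plaquette 3 L × Fin 3) : ℝ) +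
    729945 * (Fintype.card (Plaquette 3 L) : ℝ))) with hcstar
  set c₁ : ℝ := Real.exp (-(β * ((Fintype.card (Edge 3 L) : ℝ) * (2 * s + 2 * Real.sqrt 2 * s) ^ 2)) -
        β / 2 * (((10 * Real.sqrt (Fintype.card (Plaquette 3 L × Fin 3)) * s) ^ 2 + stepActionErr (L := L) s 0) +
          ((10 * Real.sqrt (Fintype.card (Plaquette 3 L × Fin 3)) * s) ^ 2 + stepActionErr (L := L) s 0))) with hc₁
  set I₀ : ℝ := ∫ v, Ω (linkEmbed L v) ∂orthoTransverse L with hI₀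
  set Mm : ℝ := ∫ v, Ω (linkEmbed L v) * (Real.sqrt β * ‖linkEmbed L v‖) ^ (3 * n) ∂orthoTransverse L with hMm
  set θ : ℝ := ∫ v in C, Ω (linkEmbed L v) ∂orthoTransverse L with hθdef
  set τ₀ : ℝ := ∫ v in {v | T < β * ‖linkEmbed L v‖ ^ 2}, Ω (linkEmbed L v) ∂orthoTransverse L with hτ₀
  set Z : ℝ := fpZ ε with hZ
  set abc : ℝ := (π ^ 2 / 12) ^ n * (3 * (L : ℝ)) ^ (3 * n) * 3 ^ (3 * n) with habc
  set Kk : ℝ := 5 * Real.exp (1 / 2) * 4 ^ (3 * n) * (3 * n).factorial with hKk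
  set E₁ : ℝ := Real.exp (β * stepActionErr (L := L) Rτ ((L : ℝ) ^ 3 * (12 * orbitDist u ^ 4))) with hE₁
  set K1 : ℝ := transferKernel su2Rep ((L : ℝ) ^ 3 * β) (1 : GaugeConfig 3 1 SU2) 1 with hK1
  set F : ℝ := (∫ p, fpTriple L β Ω (fpWeight L ε) 1 1 p ∂((orthoTransverse L).prod ((orthoTransverse L).prod (gaugeMeasure L)))) / K1 with hFdef
  set X : ℝ := (Real.sqrt β * (3 * orbitDist u)) ^ (3 * n) with hX
  have hKk0 : 0 ≤ Kk := by rw [hKk]; positivity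
  have hE₁0 : 0 ≤ E₁ := (Real.exp_pos _).le
  have hX0 : 0 ≤ X := by rw [hX]; positivity
  have hc₁ge : cstar ≤ c₁ := floorConst_le (L := L) hβ
  have hI0 : 0 ≤ I₀ := integral_nonneg fun v => hΩ0 _
  have hM0 : 0 ≤ Mm := integral_nonneg fun v => mul_nonneg (hΩ0 _) (by positivity)
  have hFfloor : c₁ * (Z * (s ^ 3 / 10) ^ n * θ ^ 2) ≤ F := by
    rw [hFdef, le_div_iff₀ hK1p]
    calc c₁ * (Z * (s ^ 3 / 10) ^ n * θ ^ 2) * K1 = K1 * (c₁ * (Z * (s ^ 3 / 10) ^ n * θ ^ 2)) := by ring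
      _ ≤ _ := hfloor
  have hF0 : 0 ≤ F := by
    rw [hFdef]
    refine div_nonneg (integral_nonneg fun p => ?_) hK1p.le
    unfold fpTriple; exact mul_nonneg (hΩ0 _) (mul_nonneg (mul_nonneg (fpWeight_mem_Icc L ε _).1 (transferKernel_pos _ _ _ _).le) (hΩ0 _))
  -- the kinetic numerator against `θ²`
  have hW1 : 3 ^ (3 * n) * (1 + 2 * X) * I₀ ^ 2 + c5 * I₀ * Mm ≤ (3 ^ (3 * n) + c5) * A ^ 2 * (1 + 2 * X) * θ ^ 2 := by
    have h1' : I₀ ^ 2 ≤ (A * θ) ^ 2 := pow_le_pow_left₀ hI0 hI 2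
    have h2' : I₀ * Mm ≤ (A * θ) * (A * θ) := mul_le_mul hI hM hM0 (by positivity)
    have hc50' : 0 ≤ c5 := hc50
    have h3' : c5 * I₀ * Mm ≤ c5 * (A * θ) ^ 2 * (1 + 2 * X) := by
      have := mul_le_mul_of_nonneg_left h2' hc50'
      have h4 : c5 * (A * θ) ^ 2 ≤ c5 * (A * θ) ^ 2 * (1 + 2 * X) := le_mul_of_one_le_right (by positivity) (by linarith)
      have e1 : c5 * I₀ * Mm = c5 * (I₀ * Mm) := by ring
      have e2 : c5 * ((A * θ) * (A * θ)) = c5 * (A * θ) ^ 2 := by ring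
      linarith
    have h5 : 3 ^ (3 * n) * (1 + 2 * X) * I₀ ^ 2 ≤ 3 ^ (3 * n) * (1 + 2 * X) * (A * θ) ^ 2 := mul_le_mul_of_nonneg_left h1' (by positivity)
    have e3 : (3 ^ (3 * n) + c5) * A ^ 2 * (1 + 2 * X) * θ ^ 2 = 3 ^ (3 * n) * (1 + 2 * X) * (A * θ) ^ 2 + c5 * (A * θ) ^ 2 * (1 + 2 * X) := by ring
    linarith
  -- the three pieces
  have hp1 : E₁ * (Real.exp (-(β * D / 2)) * (Kk * (Z * (abc * s ^ (3 * n)) * (3 ^ (3 * n) * (1 + 2 * X) * I₀ ^ 2 + c5 * I₀ * Mm)))) ≤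
      E₁ * (Real.exp (-(β * D / 2)) * (Kk * abc * 10 ^ n * ((3 ^ (3 * n) + c5) * A ^ 2 * (1 + 2 * X)) / cstar * F)) := by
    refine mul_le_mul_of_nonneg_left (mul_le_mul_of_nonneg_left ?_ (Real.exp_pos _).le) hE₁0
    have h := slow_kin_coeff (n := n) (a := (π ^ 2 / 12) ^ n) (b := (3 * (L : ℝ)) ^ (3 * n)) (c := (3 : ℝ) ^ (3 * n)) hKk0 hfpZ hs0 (by positivity)
      (by positivity : (0 : ℝ) ≤ (3 ^ (3 * n) + c5) * A ^ 2 * (1 + 2 * X)) hW1 hcstar0 hc₁ge hFfloor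
    rw [habc]; exact h
  have hcls : 0 < cl * s := mul_pos hcl hs0
  have hsinv : s⁻¹ = Real.sqrt β := by rw [hs, inv_inv]
  have hsβ : 0 < Real.sqrt β := Real.sqrt_pos.mpr hβ0
  have e2 : 80 * 10 ^ n * A / (cstar * (cl * s) ^ 3) * t * (s⁻¹) ^ (3 * n + 3) * F = 80 * 10 ^ n * A / (cstar * cl ^ 3) * t * Real.sqrt β ^ (3 * n + 6) * F := by
    rw [hsinv, hs, mul_pow, inv_pow, pow_add, pow_add]
    field_simp
  have hp2 : E₁ * (τ₀ * I₀) ≤ E₁ * (80 * 10 ^ n * A / (cstar * cl ^ 3) * t * Real.sqrt β ^ (3 * n + 6) * F) := by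
    rw [← e2]; exact mul_le_mul_of_nonneg_left (slow_fib_coeff (n := n) hs0 hθ.le hI0 ht hA htail0 hI hcls hZl hcstar0 hc₁ge hFfloor) hE₁0
  have hp3 : E₁ * (I₀ * τ₀) ≤ E₁ * (80 * 10 ^ n * A / (cstar * cl ^ 3) * t * Real.sqrt β ^ (3 * n + 6) * F) := by
    rw [mul_comm I₀ τ₀]; exact hp2
  refine hcore.trans ?_
  have hsum := add_le_add (add_le_add hp1 hp2) hp3
  refine hsum.trans (le_of_eq ?_)
  ring

end Summit.QuantumFields.YangMills.Theorems.FemtoTransferGap.RateTube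

end
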